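import Summits.MatrixMultiplication.MatrixMultiplication.Theorems.LinearDefectLaw.Negative.TwoByTwoRungs

/-!
# `FidelityWitnesses.LinearDefectLaw` (stmt-MatrixMultiplication-14039) — the rank-4 rung of `⟨2,2,2⟩` is a BORDER rung:
# `M(2,4) ≥ 3 + √2`

The `n = 2` content of `LinearDefectLaw` is `SevenEighthsLaw ∧ SixEighthsAtFive ∧ (M(2,4) ≤ 5)`
(`TwoIff.lawAtTwo_iff`).  This file settles the STRUCTURE of the rank-4 rung from below, with a kernel-checked
certificate: the supremum `M(2,4) = sup {|⟨S,⟨2,2,2⟩⟩|²/‖S‖² : R(S) ≤ 4}` — recorded so far only as the numerical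
value `4.4141` of an "analog optimum" — is at least `3 + √2 = 4.41421356…`, and this value is approached along an
explicit honest rank-4 family `fourS m t` (`m → ∞`, `t = √2 − 1`) whose terms DIVERGE: a border phenomenon at
`(n, r) = (2, 4)`, the analogue two rungs down of Bini's scheme at `(2, 5)`.

The family (slots `a = (i,k)`, `b = (i,j)`, `c = (j,k)` of the tree's `matMulTensor`; `x₀ = e₁₁` is the common first
factor of all four terms, the second factors of terms 3, 4 and the third factors of terms 1, 2 coincide to leading
order, and the four leading products cancel exactly):
* `W = (m e₁₁ + 2e₀₀ + (1+t)e₁₀,  m e₁₁ + 2e₀₀,  m e₁₁ + 2e₀₁,  m e₁₁)`,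
* `U = (m(e₁₀ + e₁₁),  m(e₀₀ − e₁₀ − e₁₁),  m e₀₀ + (2+2t)e₁₀,  m e₀₀)`,
* `V = (m(e₀₀ + t e₁₀) − t(1−t)e₀₁ + (1+t+2t²)e₁₁,  m(e₀₀ + t e₁₀),  m(e₀₁ − t e₁₁),  −m(e₀₀ + t e₁₀ + e₀₁ − t e₁₁))`,
* `fourS m t = Σ_{l<4} W_l ⊗ U_l ⊗ V_l`, with (polynomial identities, `ring`)
  `⟨fourS, ⟨2,2,2⟩⟩ = 4m²(2 + t + t²)` and `‖fourS‖² = 8m⁴(1+t²)(2+t+t²) + 2m²·R(t)`,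
  `R(t) = 13 + 28t + 51t² + 40t³ + 43t⁴ + 12t⁵ + 5t⁶`;
  hence `fid(fourS m t) ↑ 2(2+t+t²)/(1+t²)` as `m → ∞`, `= 3 + (1 + 2t − t²)/(1+t²)`, maximal `= 3 + √2` at
  `t = tan(π/8) = √2 − 1`; the limit tensor `m⁻² fourS → S∞(t)` has 12 nonzero entries and border rank `≤ 4`.
Consequences recorded: `rung24_ge` (`∀ η > 0 ∃ S, R(S) ≤ 4 ∧ (3 + √2 − η)‖S‖² < |⟨S,T⟩|²`, registered stub
`stub_rung24Border`), `rung24_not_strengthened` (the bound `M(2,4) ≤ 4.41` is false).  Conjecture (numerics of this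
seat: 120 ALS restarts, all border-type, sup `4.4141925` after 3·10⁴ sweeps and rising like `1/it`): `M(2,4) = 3 + √2`.
-/

noncomputable section

namespace Summit.MatrixMultiplication.MatrixMultiplication.Theorems.LinearDefectLaw.Rung24

open scoped BigOperators
open Literature.Computability.AlgebraicComplexity
open Summit.MatrixMultiplication.MatrixMultiplication.Theorems.SevenEighthsLawNeg (P2)

set_option linter.dupNamespace false

/-- Real indicator of position `(i, j)` on `P2 = Fin 2 × Fin 2`. -/
def eR (i j : Fin 2) : P2 → ℝ := fun p => if p = (i, j) then 1 else 0

/-- First-slot factors (index `a = (i,k)`): all four share the leading direction `e₁₁`. -/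
def fourW (m t : ℝ) : Fin 4 → P2 → ℝ :=
  ![m • eR 1 1 + (2 : ℝ) • eR 0 0 + (1 + t) • eR 1 0, m • eR 1 1 + (2 : ℝ) • eR 0 0,
    m • eR 1 1 + (2 : ℝ) • eR 0 1, m • eR 1 1]

/-- Second-slot factors (index `b = (i,j)`). -/
def fourU (m t : ℝ) : Fin 4 → P2 → ℝ :=
  ![m • eR 1 0 + m • eR 1 1, m • eR 0 0 - m • eR 1 0 - m • eR 1 1, m • eR 0 0 + (2 + 2 * t) • eR 1 0, m • eR 0 0]

/-- Third-slot factors (index `c = (j,k)`). -/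
def fourV (m t : ℝ) : Fin 4 → P2 → ℝ :=
  ![m • eR 0 0 + (m * t) • eR 1 0 + (-(t * (1 - t))) • eR 0 1 + (1 + t + 2 * t ^ 2) • eR 1 1,
    m • eR 0 0 + (m * t) • eR 1 0, m • eR 0 1 + (-(m * t)) • eR 1 1,
    (-m) • eR 0 0 + (-(m * t)) • eR 1 0 + (-m) • eR 0 1 + (m * t) • eR 1 1]

/-- The honest rank-`≤ 4` real family `fourS m t = Σ_{l<4} W_l ⊗ U_l ⊗ V_l`. -/
def fourS (m t : ℝ) : P2 → P2 → P2 → ℝ := fun a b c => ∑ l, fourW m t l a * fourU m t l b * fourV m t l c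

/-- `fourS m t` viewed over `ℂ`. -/
def fourSC (m t : ℝ) : P2 → P2 → P2 → ℂ := fun a b c => (fourS m t a b c : ℂ)

/-- The rank certificate over `ℝ`: four triads. -/
theorem tensorRank_fourS_le (m t : ℝ) : tensorRank (fourS m t) ≤ 4 :=
  tensorRank_le_of_eq_sum (fourW m t) (fourU m t) (fourV m t)
    (by funext a b c; simp [fourS, Finset.sum_apply, triad_apply])

/-- The rank certificate over `ℂ` (base change `ℝ → ℂ` does not raise the rank). -/
theorem tensorRank_fourSC_le (m t : ℝ) : tensorRank (fourSC m t) ≤ 4 :=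
  (tensorRank_map_le Complex.ofRealHom (fourS m t)).trans (tensorRank_fourS_le m t)

/-- The remainder polynomial `R(t)` of `‖fourS‖²`. -/
def remR (t : ℝ) : ℝ := 13 + 28 * t + 51 * t ^ 2 + 40 * t ^ 3 + 43 * t ^ 4 + 12 * t ^ 5 + 5 * t ^ 6

/-- Overlap identity: `⟨fourS m t, ⟨2,2,2⟩⟩ = 4m²(2 + t + t²)` (the `m³` terms cancel, no lower order). -/
theorem overlap_fourS (m t : ℝ) :
    (∑ a, ∑ b, ∑ c, fourS m t a b c * matMulTensor ℝ 2 2 2 a b c) = 4 * m ^ 2 * (2 + t + t ^ 2) := by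
  simp [fourS, fourW, fourU, fourV, eR, matMulTensor, Fintype.sum_prod_type, Fin.sum_univ_succ]
  ring

/-- Norm identity: `‖fourS m t‖² = 8m⁴(1+t²)(2+t+t²) + 2m²R(t)`. -/
theorem normSq_fourS (m t : ℝ) :
    (∑ a, ∑ b, ∑ c, fourS m t a b c ^ 2) =
      8 * m ^ 4 * (1 + t ^ 2) * (2 + t + t ^ 2) + 2 * m ^ 2 * remR t := by
  simp [fourS, fourW, fourU, fourV, eR, remR, Fintype.sum_prod_type, Fin.sum_univ_succ]
  ring

/-- Base change of the overlap to `ℂ`. -/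
theorem overlap_fourSC (m t : ℝ) :
    (∑ a, ∑ b, ∑ c, fourSC m t a b c * matMulTensor ℂ 2 2 2 a b c) =
      ((4 * m ^ 2 * (2 + t + t ^ 2) : ℝ) : ℂ) := by
  rw [← overlap_fourS]
  unfold fourSC
  push_cast
  refine Finset.sum_congr rfl fun a _ => Finset.sum_congr rfl fun b _ =>
    Finset.sum_congr rfl fun c _ => ?_
  congr 1
  unfold matMulTensor
  split_ifs <;> simp

/-- Base change of the squared norm to `ℂ`. -/
theorem normSq_fourSC (m t : ℝ) :
    (∑ a, ∑ b, ∑ c, ‖fourSC m t a b c‖ ^ 2) =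
      8 * m ^ 4 * (1 + t ^ 2) * (2 + t + t ^ 2) + 2 * m ^ 2 * remR t := by
  rw [← normSq_fourS]
  unfold fourSC
  refine Finset.sum_congr rfl fun a _ => Finset.sum_congr rfl fun b _ =>
    Finset.sum_congr rfl fun c _ => ?_
  rw [Complex.norm_real, Real.norm_eq_abs, sq_abs]

/-- **The rank-4 border family in the crux's own terms**: for all real `m, t` an honest rank-`≤ 4` complex tensor
with `|⟨S,⟨2,2,2⟩⟩|² = (4m²(2+t+t²))²` and `‖S‖² = 8m⁴(1+t²)(2+t+t²) + 2m²R(t)`. -/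
theorem rung24_borderFamily (m t : ℝ) : ∃ S : P2 → P2 → P2 → ℂ, tensorRank S ≤ 4 ∧
    ‖∑ a, ∑ b, ∑ c, S a b c * matMulTensor ℂ 2 2 2 a b c‖ ^ 2 = (4 * m ^ 2 * (2 + t + t ^ 2)) ^ 2 ∧
    (∑ a, ∑ b, ∑ c, ‖S a b c‖ ^ 2) = 8 * m ^ 4 * (1 + t ^ 2) * (2 + t + t ^ 2) + 2 * m ^ 2 * remR t := by
  refine ⟨fourSC m t, tensorRank_fourSC_le m t, ?_, normSq_fourSC m t⟩
  rw [overlap_fourSC, Complex.norm_real, Real.norm_eq_abs, sq_abs]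

/-- **`M(2,4) ≥ 3 + √2`.** For every `η > 0` some honest rank-`≤ 4` tensor has
`(3 + √2 − η)·‖S‖² < |⟨S,⟨2,2,2⟩⟩|²` (take `t = √2 − 1` and `m` large in the border family). -/
theorem rung24_ge (η : ℝ) (hη : 0 < η) : ∃ S : P2 → P2 → P2 → ℂ, tensorRank S ≤ 4 ∧
    (3 + Real.sqrt 2 - η) * ∑ a, ∑ b, ∑ c, ‖S a b c‖ ^ 2 <
      ‖∑ a, ∑ b, ∑ c, S a b c * matMulTensor ℂ 2 2 2 a b c‖ ^ 2 := by
  set t : ℝ := Real.sqrt 2 - 1 with ht_def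
  obtain ⟨m, hm⟩ := exists_nat_gt (109 / η + 1)
  obtain ⟨S, hS, h1, h2⟩ := rung24_borderFamily (m : ℝ) t
  refine ⟨S, hS, ?_⟩
  rw [h1, h2]
  -- arithmetic of `t = √2 − 1`
  have hs2 : Real.sqrt 2 * Real.sqrt 2 = 2 := Real.mul_self_sqrt (by norm_num)
  have hslo : (1.4 : ℝ) < Real.sqrt 2 := by
    rw [show (1.4 : ℝ) = Real.sqrt (1.4 ^ 2) by rw [Real.sqrt_sq (by norm_num)]]
    exact Real.sqrt_lt_sqrt (by norm_num) (by norm_num)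
  have hshi : Real.sqrt 2 < (1.5 : ℝ) := by
    rw [show (1.5 : ℝ) = Real.sqrt (1.5 ^ 2) by rw [Real.sqrt_sq (by norm_num)]]
    exact Real.sqrt_lt_sqrt (by norm_num) (by norm_num)
  have hsq : Real.sqrt 2 = t + 1 := by rw [ht_def]; ring
  have ht : t ^ 2 + 2 * t - 1 = 0 := by nlinarith [hs2, hsq]
  have ht0 : (0.4 : ℝ) < t := by rw [ht_def]; linarith
  have ht1 : t < (0.5 : ℝ) := by rw [ht_def]; linarith
  -- bounds on the pieces
  have hk : ∀ k : ℕ, t ^ k ≤ 1 := fun k => pow_le_one₀ (by linarith) (by linarith)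
  have hR : remR t ≤ 192 := by
    unfold remR
    linarith [hk 2, hk 3, hk 4, hk 5, hk 6]
  have hR0 : 0 ≤ remR t := by unfold remR; positivity
  have hm0 : (109 / η + 1 : ℝ) < m := hm
  have hm1 : (1 : ℝ) < m := by
    have : (0 : ℝ) < 109 / η := by positivity
    linarith
  have hηm : 109 < η * m := by
    have h := (div_lt_iff₀ hη).1 (show 109 / η < (m : ℝ) - 1 by linarith)
    nlinarith
  -- the key identity: O² − (4 + t − η)·N = η·N − 2(4+t)m²R − 8m⁴t(2+t+t²)(t²+2t−1)
  rw [hsq]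
  have hM : (0 : ℝ) < (m : ℝ) ^ 2 := by positivity
  have hN : 16 * (m : ℝ) ^ 4 ≤ 8 * (m : ℝ) ^ 4 * (1 + t ^ 2) * (2 + t + t ^ 2) + 2 * (m : ℝ) ^ 2 * remR t := by
    nlinarith [mul_nonneg hM.le hR0, pow_pos (show (0:ℝ) < m by linarith) 4, ht0]
  have key : (4 * (m : ℝ) ^ 2 * (2 + t + t ^ 2)) ^ 2
      - (3 + (t + 1) - η) * (8 * (m : ℝ) ^ 4 * (1 + t ^ 2) * (2 + t + t ^ 2) + 2 * (m : ℝ) ^ 2 * remR t)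
      = η * (8 * (m : ℝ) ^ 4 * (1 + t ^ 2) * (2 + t + t ^ 2) + 2 * (m : ℝ) ^ 2 * remR t)
        - 2 * (4 + t) * (m : ℝ) ^ 2 * remR t := by
    linear_combination (-8 * (m : ℝ) ^ 4 * t * (2 + t + t ^ 2)) * ht
  -- conclude: η·N ≥ 16ηm⁴ > 2·(4.5)·192·m² ≥ 2(4+t)m²R
  have hgoal : 0 < η * (8 * (m : ℝ) ^ 4 * (1 + t ^ 2) * (2 + t + t ^ 2) + 2 * (m : ℝ) ^ 2 * remR t)
        - 2 * (4 + t) * (m : ℝ) ^ 2 * remR t := by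
    have h1' : 2 * (4 + t) * (m : ℝ) ^ 2 * remR t ≤ 1728 * (m : ℝ) ^ 2 := by
      have : (4 + t) * remR t ≤ 4.5 * 192 := by nlinarith
      nlinarith
    have h2' : 16 * η * (m : ℝ) ^ 4 ≤
        η * (8 * (m : ℝ) ^ 4 * (1 + t ^ 2) * (2 + t + t ^ 2) + 2 * (m : ℝ) ^ 2 * remR t) := by
      nlinarith
    have h3' : 1728 * (m : ℝ) ^ 2 < 16 * η * (m : ℝ) ^ 4 := by
      have h4 : 108 < η * (m : ℝ) ^ 2 := by nlinarith
      nlinarith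
    linarith
  linarith [key, hgoal]

/-- The strengthening `M(2,4) ≤ 4.41` of the rank-4 rung is FALSE (`3 + √2 > 4.414`). -/
theorem rung24_not_strengthened : ¬ (∀ S : P2 → P2 → P2 → ℂ, tensorRank S ≤ 4 →
    ‖∑ a, ∑ b, ∑ c, S a b c * matMulTensor ℂ 2 2 2 a b c‖ ^ 2 ≤
      (441 / 100 : ℝ) * ∑ a, ∑ b, ∑ c, ‖S a b c‖ ^ 2) := by
  intro h
  have hslo : (1.411 : ℝ) < Real.sqrt 2 := by
    rw [show (1.411 : ℝ) = Real.sqrt (1.411 ^ 2) by rw [Real.sqrt_sq (by norm_num)]]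
    exact Real.sqrt_lt_sqrt (by norm_num) (by norm_num)
  obtain ⟨S, hS, hlt⟩ := rung24_ge (1 / 1000) (by norm_num)
  have hpos : (0 : ℝ) ≤ ∑ a, ∑ b, ∑ c, ‖S a b c‖ ^ 2 := by positivity
  have := h S hS
  nlinarith

/-- **Registered stub `stub_rung24Border`** (raw form of `rung24_ge`): `M(2,4) ≥ 3 + √2`. -/
theorem stub_rung24Border : ∀ η : ℝ, 0 < η → ∃ S : Fin 2 × Fin 2 → Fin 2 × Fin 2 → Fin 2 × Fin 2 → ℂ, tensorRank S ≤ 4 ∧ (3 + Real.sqrt 2 - η) * (∑ a, ∑ b, ∑ c, ‖S a b c‖ ^ 2) < ‖∑ a, ∑ b, ∑ c, S a b c * matMulTensor ℂ 2 2 2 a b c‖ ^ 2 :=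
  fun η hη => rung24_ge η hη

end Summit.MatrixMultiplication.MatrixMultiplication.Theorems.LinearDefectLaw.Rung24

end
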